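import Summits.QuantumFields.YangMills.Theorems.UnitScaleTiltProp8FlatChart47Levels
import Literature.MathematicalPhysics.QuantumFieldTheory.Balaban1983to89.B12LinearizAnalytic267
import Literature.Analysis.Complex.OsgoodProofs
import HarnessLib

/-!
# Route `UnitScaleTilt`, crux K1 child «MinimiserStabilityRegPr» (stmt-QuantumFields-19200), registered stub V2′ `stub_halvingStep` — pillar F4 ∕ P3a,
# row **(X4) «the chart `D(·)` of [Balaban1985Variational] Prop. 3 is a HOLOMORPHIC MAP»**, CHART-AGNOSTIC EDITION (★★OWNER RULING g26-№5 «over ABSTRACT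
# contraction data (C, H, smallness), no `chartLog`-specific lemma»; RULING g26-№6 (S6) «(X4) closes BY NAME after (S3) via the abstract core fed with `hCd♭`∕`hquad♭`»):
# **`FlatChart47Levels.chart47W`'s small solution `D(A′)` of `C(A′ − HD) = D` IS ANALYTIC IN `A′` on the weighted ball — for EVERY solution family, in F4's
# weighted-sup letters** — a READING of lit-balaban's abstract analytic implicit-function module
# `B12LinearizAnalytic267` (§4 `analyticOnNhd_Dt`) through the weighted carriers `B11Eq115Space.NegSup`, with OSGOOD's lemma
# (`Literature.Analysis.Complex.SCV.analyticOnNhd_of_differentiableOn`) turning F4's holomorphy letter `hCd` into analyticity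

Cell `ym3-torus` (HUMAN RULING D-0037, YM ladder rung R3 — continuum SU(2) YM₃ on the torus is a RUNG, not the Clay problem), width seat `ym-ust-19936-w7`
gen 2 (row handed over by ★w3-19200 g4, bus 06:34:21Z).  `--supports stmt-QuantumFields-19200 --as helper`; def-free, 0 sorry, standard axioms.

WHY.  The dressing consumers of pillar P3b (`FlatProp4Dressing.hWq_of_dressing`∕`hWd_of_dressing`: `hDd : DifferentiableOn ℂ D {w₀-ball}`; the M2 knit
`HalvingDressingLetter.exists_hWq_dressed_cubeSeq_T3_of_columnLetters`: `h49`∕`hDd`∕`hCd` near every sized field) need the chart `D(·)` as a MAP, holomorphic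
on the weighted ball, while F4's `chart47W` delivers it POINTWISE (`∀ A′, ∃! D`).  Print (p. 286): *«This solution is … an analytic function of A′»*; Prop. 3
p. 289: *«defined and analytic»*.  The abstract statement — Banach `𝒴 𝒳`, `‖hX‖ ≤ b‖X‖`, `C` quadratically bounded and analytic on `‖Y‖ < R`, `9C₂bε < 1`,
`3ε ≤ R` ⟹ every small solution family of `C(B − hD) = D` on `‖B‖ < ε` is Fréchet-analytic — is lit-balaban's `B12LinearizAnalytic267.analyticOnNhd_Dt`
(complex-analytic implicit function theorem, identification by continuity).  THIS FILE transports it to F4's letters exactly as `chart47W` transports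
`B13Contraction113` (carriers `NegSup w₀ V`, `NegSup wB V`), the extra analyticity input being FREE in finite dimension (Osgood: ℂ-differentiable on an
open set ⇒ analytic).  Nothing here mentions a specific chart: at the carrier (`ι = PBond (F.P K) 0`, `β = BondIdx D`, `V = M₂(ℂ)`, `w₀ = w 1`,
`wB = 1`) the data `hCq`∕`hCd` are the P3a letters of the chart of record — the double-bar `chartLogFlat` of RULING g26-№6 (S1)∕(S3) once re-read, or the
retired single-bar `chartLog` via `Prop8Chart.chartRemainder_hCd_hCq` — and `hH` is (46) for `H` (`flatH`: `FlatCubeOpsText.HSupLetterG`, (S5)).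

WHAT THIS FILE PROVES (finite `ι β`, positive weights `w₀ wB`, `V` finite-dimensional complex; «size `Y` ≤ r» := `∀ i, w₀ i‖Y i‖ ≤ r`; the data of
`chart47W`: `hCq`, `hCd`, the (46) letter `hH` (GUARDED form `0 ≤ t → …`, implied by F4's), `9C₂B₀ε < 1`, `3ε ≤ R`, `0 < ε`):
* §1 `isOpen_wBall`, `analyticOnNhd_of_differentiableOn_wBall` (Osgood in the weighted letters), `quadAnalytic_transport`∕`analyticOnNhd_transport`∕
  `norm_transport_le` (the `NegSup` transports of `C` and `H`).
* §2 ★★★ `analyticOnNhd_chart47W` — EVERY `Dsel : (ι → V) → (β → V)` with size `Dsel A′ ≤ 4C₂ε²` and `C(A′ − H·Dsel A′) = Dsel A′` on the open `w₀`-ball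
  `< ε` is `AnalyticOnNhd ℂ` there; `differentiableOn_chart47W`, `contDiffOn_chart47W`, ★ `differentiableOn_fderiv_chart47W` (the derivative is holomorphic too).
* §3 the SIZED-FIELD currency (`size Y ≤ r < ε`) of the dressing knits: `differentiableAt_chart47W_of_size_le` (hDd), `analyticAt_chart47W_of_size_le`,
  `hasFDerivAt_chart47W_of_size_le`, ★ `eventually_fix_of_size_le` (h49: `∀ᶠ X in 𝓝 Y, Dsel X = C (X − H (Dsel X))`), `size_shift_lt_of_size_le`
  ((57): the shifted field stays in the `R`-ball), ★ `differentiableAt_shift_of_size_le` (hCd: `DifferentiableAt ℂ C (Y − H (Dsel Y))`).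
* §4 ★★ `exists_analytic_chart47W` — the selector edition of `chart47W`: ONE map `Dsel`, analytic on the `ε`-ball, with (49)∕(50) (uniqueness)∕(55)∕(48)
  at every point.
HONEST SCOPE.  Functional analysis over DISPLAYED abstract data (`C`, `H`, the smallness); no estimate of [Balaban1985Variational] is asserted; at the
carrier the data are P3a's `chartRemainder_hCd_hCq` + `ChartHInv.hH_of_flatH` (today's chart) or their re-based twins; NOT a claim about the stub
`stub_halvingStep`, the crux, the rung or the mass gap; no summit statement is proved by this seat.

References: T. Bałaban, CMP **102** (1985) 277–309 [Balaban1985Variational] (44)–(50) p.285, (53)–(57) p.286, (63)–(73) pp.287–289, Prop. 3 p.289;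
CMP **109** (1987) 249–301 [Balaban1987RG1] p.267; L. Hörmander, *An Introduction to Complex Analysis in Several Variables* [HormanderSCV1973] Thm 2.2.1, 2.2.6.
-/

set_option autoImplicit false

noncomputable section

open Metric Set Filter
open scoped Topology ContDiff

namespace Summit.QuantumFields.YangMills.Theorems.Chart47Analytic

open Literature.MathematicalPhysics.QuantumFieldTheory.Balaban1983to89
open Literature.MathematicalPhysics.QuantumFieldTheory.Balaban1983to89.B11Eq115Space
open Literature.MathematicalPhysics.QuantumFieldTheory.Balaban1983to89.B13Contraction113 (QuadAnalytic exists_unique_fixedPoint bound_114)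
open Literature.MathematicalPhysics.QuantumFieldTheory.Balaban1983to89.B12LinearizAnalytic267 (analyticOnNhd_Dt)
open Summit.QuantumFields.YangMills.Theorems.FlatChart47Levels (chart47W size_chart47W_le)

variable {ι β : Type*} [Fintype ι] [Fintype β] {V : Type*} [NormedAddCommGroup V] [NormedSpace ℂ V]

/-! ## §1 Weighted balls are open; Osgood in the weighted letters; the `NegSup` transports -/

omit [Fintype ι] [NormedSpace ℂ V] in
/-- The weighted ball `{Y | ∀ i, w₀ i·‖Y i‖ < R}` is open in `ι → V` (finitely many strict inequalities). [folklore] -/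
theorem isOpen_wBall [Finite ι] (w₀ : ι → ℝ) (R : ℝ) : IsOpen {Y : ι → V | ∀ i, w₀ i * ‖Y i‖ < R} := by
  rw [Set.setOf_forall]
  exact isOpen_iInter_of_finite fun i => isOpen_lt (continuous_const.mul (continuous_apply i).norm) continuous_const

/-- **OSGOOD IN THE WEIGHTED LETTERS**: F4's holomorphy letter `hCd : DifferentiableOn ℂ C {w₀-ball R}` already makes `C` ANALYTIC on a neighbourhood of every
point of that ball (finite-dimensional source, complete target). [cite: HormanderSCV1973, Thm 2.2.1 and Thm 2.2.6] -/
theorem analyticOnNhd_of_differentiableOn_wBall [FiniteDimensional ℂ V] (w₀ : ι → ℝ) (R : ℝ) (C : (ι → V) → (β → V))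
    (hCd : DifferentiableOn ℂ C {Y : ι → V | ∀ i, w₀ i * ‖Y i‖ < R}) :
    AnalyticOnNhd ℂ C {Y : ι → V | ∀ i, w₀ i * ‖Y i‖ < R} := by
  haveI : CompleteSpace V := FiniteDimensional.complete ℂ V
  exact Literature.Analysis.Complex.SCV.analyticOnNhd_of_differentiableOn hCd (isOpen_wBall w₀ R)

section Transport

variable {w₀ : ι → ℝ} {wB : β → ℝ} [Fact (∀ i, 0 < w₀ i)] [Fact (∀ c, 0 < wB c)]

/-- **THE TRANSPORTED `H` IS BOUNDED BY `B₀`** on the weighted carriers (`‖H̃X‖_{w₀} ≤ B₀‖X‖_{wB}`) from the GUARDED (46) letter.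
[cite: Balaban1985Variational, (46) p.285] -/
theorem norm_transport_le (H : (β → V) →ₗ[ℂ] (ι → V)) {B₀ : ℝ} (hB₀ : 0 ≤ B₀)
    (hH : ∀ (X : β → V) (t : ℝ), 0 ≤ t → (∀ c, wB c * ‖X c‖ ≤ t) → ∀ i, w₀ i * ‖H X i‖ ≤ B₀ * t)
    (X : NegSup wB V) : ‖(NegSup.equiv w₀ V).symm (H (NegSup.equiv wB V X))‖ ≤ B₀ * ‖X‖ := by
  rw [NegSup.norm_le_iff (mul_nonneg hB₀ (norm_nonneg _))]
  exact hH _ ‖X‖ (norm_nonneg _) (fun c => NegSup.weight_mul_norm_apply_le X c)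

/-- **THE TRANSPORTED `C` IS `QuadAnalytic`** (quadratic bound below `R` + holomorphy along complex lines) from F4's `hCq`∕`hCd` — the construction inside
`chart47W`, stated once. [cite: Balaban1985Variational, (44) p.285, (53) p.286] -/
theorem quadAnalytic_transport (C : (ι → V) → (β → V)) {C₂ R : ℝ} (hC₂ : 0 ≤ C₂)
    (hCq : ∀ (Y : ι → V) (r : ℝ), r < R → (∀ i, w₀ i * ‖Y i‖ ≤ r) → ∀ c, wB c * ‖C Y c‖ ≤ C₂ * r ^ 2)
    (hCd : DifferentiableOn ℂ C {Y : ι → V | ∀ i, w₀ i * ‖Y i‖ < R}) :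
    QuadAnalytic (fun Y : NegSup w₀ V => (NegSup.equiv wB V).symm (C (NegSup.equiv w₀ V Y))) C₂ R := by
  have hw₀ : ∀ i, 0 < w₀ i := Fact.out
  refine ⟨fun Y hY => ?_, fun Pt Q => ?_⟩
  · rw [NegSup.norm_le_iff (mul_nonneg hC₂ (sq_nonneg _))]
    exact hCq _ ‖Y‖ hY (fun i => NegSup.weight_mul_norm_apply_le Y i)
  · have hR0 : ∀ ζ : ℂ, ‖Pt + ζ • Q‖ < R → 0 < R := fun ζ h => (norm_nonneg _).trans_lt h
    have hline : Differentiable ℂ (fun ζ : ℂ => NegSup.equiv w₀ V Pt + ζ • NegSup.equiv w₀ V Q) :=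
      (differentiable_const _).add (differentiable_id.smul_const _)
    have hinto : MapsTo (fun ζ : ℂ => NegSup.equiv w₀ V Pt + ζ • NegSup.equiv w₀ V Q) {ζ : ℂ | ‖Pt + ζ • Q‖ < R}
        {Y : ι → V | ∀ i, w₀ i * ‖Y i‖ < R} := by
      intro ζ hζ
      exact (NegSup.norm_lt_iff (hR0 ζ hζ)).1 hζ
    have hcomp : DifferentiableOn ℂ (fun ζ : ℂ => C (NegSup.equiv w₀ V Pt + ζ • NegSup.equiv w₀ V Q)) {ζ : ℂ | ‖Pt + ζ • Q‖ < R} :=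
      hCd.comp hline.differentiableOn hinto
    exact (NegSup.continuousLinearEquiv ℂ wB (V := V)).symm.differentiable.comp_differentiableOn hcomp

/-- **THE TRANSPORTED `C` IS ANALYTIC ON THE NORM BALL `‖Y‖ < R`** (Osgood + the continuous linear identifications). [cite: HormanderSCV1973, Thm 2.2.1 and Thm 2.2.6] -/
theorem analyticOnNhd_transport [FiniteDimensional ℂ V] (C : (ι → V) → (β → V)) {R : ℝ}
    (hCd : DifferentiableOn ℂ C {Y : ι → V | ∀ i, w₀ i * ‖Y i‖ < R}) :
    AnalyticOnNhd ℂ (fun Y : NegSup w₀ V => (NegSup.equiv wB V).symm (C (NegSup.equiv w₀ V Y))) {Y : NegSup w₀ V | ‖Y‖ < R} := by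
  have hCan := analyticOnNhd_of_differentiableOn_wBall w₀ R C hCd
  intro Y hY
  have hR0 : 0 < R := (norm_nonneg _).trans_lt hY
  have hmem : NegSup.continuousLinearEquiv ℂ w₀ (V := V) Y ∈ {Y : ι → V | ∀ i, w₀ i * ‖Y i‖ < R} := (NegSup.norm_lt_iff hR0).1 hY
  have h1 : AnalyticAt ℂ (fun Z : NegSup w₀ V => C (NegSup.continuousLinearEquiv ℂ w₀ (V := V) Z)) Y :=
    (hCan _ hmem).comp ((NegSup.continuousLinearEquiv ℂ w₀ (V := V)).analyticAt Y)
  exact ((NegSup.continuousLinearEquiv ℂ wB (V := V)).symm.analyticAt _).comp h1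

end Transport

/-! ## §2 The main theorem: every small solution family of (49) is analytic on the weighted ball -/

section Main

variable [FiniteDimensional ℂ V] {w₀ : ι → ℝ} {wB : β → ℝ} (hw₀ : ∀ i, 0 < w₀ i) (hwB : ∀ c, 0 < wB c)
    (C : (ι → V) → (β → V)) (H : (β → V) →ₗ[ℂ] (ι → V)) {C₂ R B₀ ε : ℝ} (hC₂ : 0 ≤ C₂) (hB₀ : 0 ≤ B₀)
    (hH : ∀ (X : β → V) (t : ℝ), 0 ≤ t → (∀ c, wB c * ‖X c‖ ≤ t) → ∀ i, w₀ i * ‖H X i‖ ≤ B₀ * t)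
    (hCq : ∀ (Y : ι → V) (r : ℝ), r < R → (∀ i, w₀ i * ‖Y i‖ ≤ r) → ∀ c, wB c * ‖C Y c‖ ≤ C₂ * r ^ 2)
    (hCd : DifferentiableOn ℂ C {Y : ι → V | ∀ i, w₀ i * ‖Y i‖ < R})
    (hq : 9 * C₂ * B₀ * ε < 1) (hR : 3 * ε ≤ R) (hε : 0 < ε)
    (Dsel : (ι → V) → (β → V))
    (hDball : ∀ A' : ι → V, (∀ i, w₀ i * ‖A' i‖ < ε) → ∀ c, wB c * ‖Dsel A' c‖ ≤ 4 * C₂ * ε ^ 2)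
    (hDfix : ∀ A' : ι → V, (∀ i, w₀ i * ‖A' i‖ < ε) → C (A' - H (Dsel A')) = Dsel A')

include hw₀ hwB hC₂ hB₀ hH hCq hCd hq hR hε hDball hDfix

/-- ★★★ **[Balaban1985Variational] PROP. 3, ANALYTICITY, IN F4's WEIGHTED LETTERS — FOR EVERY SOLUTION FAMILY.**  Data of `chart47W` (`hCq`, `hCd`, the guarded
(46) letter `hH`, `9C₂B₀ε < 1`, `3ε ≤ R`, `0 < ε`); `Dsel` ANY map with, at every `A′` of the open `w₀`-ball `< ε`, size `Dsel A′ ≤ 4C₂ε²` and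
`C(A′ − H·Dsel A′) = Dsel A′`.  THEN `Dsel` is analytic on a neighbourhood of every point of that ball.  Proof: `B12LinearizAnalytic267.analyticOnNhd_Dt` on the
carriers `NegSup w₀ V → NegSup wB V` (its inputs: `quadAnalytic_transport`, `analyticOnNhd_transport`, `norm_transport_le`), read back through the continuous
linear identifications. [cite: Balaban1985Variational, (47)-(55) pp.285-286, Prop. 3 p.289; Balaban1987RG1, p.267] -/
theorem analyticOnNhd_chart47W : AnalyticOnNhd ℂ Dsel {A' : ι → V | ∀ i, w₀ i * ‖A' i‖ < ε} := by
  classical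
  haveI : CompleteSpace V := FiniteDimensional.complete ℂ V
  haveI : Fact (∀ i, 0 < w₀ i) := ⟨hw₀⟩
  haveI : Fact (∀ c, 0 < wB c) := ⟨hwB⟩
  let eY := NegSup.equiv w₀ V
  let eX := NegSup.equiv wB V
  let eYL := NegSup.continuousLinearEquiv ℂ w₀ (V := V)
  let eXL := NegSup.continuousLinearEquiv ℂ wB (V := V)
  have hρ0 : 0 ≤ 4 * C₂ * ε ^ 2 := by positivity
  -- the transported data
  let Hop : NegSup wB V →ₗ[ℂ] NegSup w₀ V :=
    { toFun := fun X => eY.symm (H (eX X))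
      map_add' := fun X X' => by
        apply eY.injective; simp only [Equiv.apply_symm_apply, eY, eX, NegSup.equiv_add, map_add]
      map_smul' := fun z X => by
        apply eY.injective; simp only [Equiv.apply_symm_apply, eY, eX, NegSup.equiv_smul, map_smul, RingHom.id_apply] }
  have hHop : ∀ X, ‖Hop X‖ ≤ B₀ * ‖X‖ := fun X => norm_transport_le H hB₀ hH X
  let Ct : NegSup w₀ V → NegSup wB V := fun Y => eX.symm (C (eY Y))
  have hCt : QuadAnalytic Ct C₂ R := quadAnalytic_transport C hC₂ hCq hCd
  have hCa : AnalyticOnNhd ℂ Ct {Y : NegSup w₀ V | ‖Y‖ < R} := analyticOnNhd_transport C hCd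
  let Dt : NegSup w₀ V → NegSup wB V := fun Y => eX.symm (Dsel (eY Y))
  have hDtball : ∀ B : NegSup w₀ V, ‖B‖ < ε → Dt B ∈ closedBall (0 : NegSup wB V) (4 * C₂ * ε ^ 2) := by
    intro B hB
    rw [mem_closedBall_zero_iff, NegSup.norm_le_iff hρ0]
    exact hDball (eY B) ((NegSup.norm_lt_iff hε).1 hB)
  have hDtfix : ∀ B : NegSup w₀ V, ‖B‖ < ε → Ct (B - Hop (Dt B)) = Dt B := by
    intro B hB
    have h := hDfix (eY B) ((NegSup.norm_lt_iff hε).1 hB)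
    exact (congrArg eX.symm h : _)
  have han : AnalyticOnNhd ℂ Dt (ball (0 : NegSup w₀ V) ε) := analyticOnNhd_Dt hCt hCa hC₂ hB₀ hHop hq hR hDtball hDtfix
  -- back to plain functions
  intro A' hA'
  have hA'n : ‖eYL.symm A'‖ < ε := (NegSup.norm_lt_iff hε).2 hA'
  have h1 : AnalyticAt ℂ Dt (eYL.symm A') := han _ (mem_ball_zero_iff.2 hA'n)
  have h2 : AnalyticAt ℂ (fun Z : ι → V => eXL (Dt (eYL.symm Z))) A' := (eXL.analyticAt _).comp (h1.comp (eYL.symm.analyticAt A'))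
  have hD : Dsel = fun Z : ι → V => eXL (Dt (eYL.symm Z)) := rfl
  rw [hD]
  exact h2

/-- `D(·)` is ℂ-differentiable on the weighted ball — the `hDd : DifferentiableOn ℂ D {…}` binder of `FlatProp4Dressing.hWq_of_dressing`∕`hWd_of_dressing`.
[cite: Balaban1985Variational, Prop. 3 p.289] -/
theorem differentiableOn_chart47W : DifferentiableOn ℂ Dsel {A' : ι → V | ∀ i, w₀ i * ‖A' i‖ < ε} :=
  (analyticOnNhd_chart47W hw₀ hwB C H hC₂ hB₀ hH hCq hCd hq hR hε Dsel hDball hDfix).differentiableOn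

/-- `D(·)` is `C^ω` on the weighted ball. [cite: Balaban1985Variational, Prop. 3 p.289] -/
theorem contDiffOn_chart47W : ContDiffOn ℂ ω Dsel {A' : ι → V | ∀ i, w₀ i * ‖A' i‖ < ε} := by
  haveI : CompleteSpace V := FiniteDimensional.complete ℂ V
  exact fun A hA => (analyticOnNhd_chart47W hw₀ hwB C H hC₂ hB₀ hH hCq hCd hq hR hε Dsel hDball hDfix A hA).contDiffAt.contDiffWithinAt

/-- ★ **THE DERIVATIVE `A′ ↦ fderiv ℂ Dsel A′` IS ITSELF HOLOMORPHIC ON THE BALL** (second-order regularity: `C^ω` on an open set) — the input behind a holomorphic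
transpose `(δD∕δA′)*` in the dressing terms (85)–(89). [cite: Balaban1985Variational, Prop. 3 p.289, Prop. 4 p.292] -/
theorem differentiableOn_fderiv_chart47W : DifferentiableOn ℂ (fderiv ℂ Dsel) {A' : ι → V | ∀ i, w₀ i * ‖A' i‖ < ε} := by
  have h := contDiffOn_chart47W hw₀ hwB C H hC₂ hB₀ hH hCq hCd hq hR hε Dsel hDball hDfix
  have h2 : ContDiffOn ℂ (1 + 1) Dsel {A' : ι → V | ∀ i, w₀ i * ‖A' i‖ < ε} := h.of_le le_top
  exact ((contDiffOn_succ_iff_fderiv_of_isOpen (isOpen_wBall w₀ ε)).1 h2).2.2.differentiableOn one_ne_zero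

/-! ## §3 The sized-field currency of the dressing knits (`size Y ≤ r < ε`) -/

omit [Fintype ι] [Fintype β] [NormedSpace ℂ V] [FiniteDimensional ℂ V] hw₀ hwB hC₂ hB₀ hH hCq hCd hq hR hε hDball hDfix in
/-- A field of size `≤ r < ε` lies in the open `ε`-ball. [folklore] -/
theorem mem_wBall_of_size_le {Y : ι → V} {r : ℝ} (hr : r < ε) (hY : ∀ i, w₀ i * ‖Y i‖ ≤ r) : ∀ i, w₀ i * ‖Y i‖ < ε :=
  fun i => (hY i).trans_lt hr

/-- ★ **hDd — `D(·)` IS ℂ-DIFFERENTIABLE AT EVERY SIZED FIELD** (`size Y ≤ r < ε`). [cite: Balaban1985Variational, Prop. 3 p.289, (63)-(73) pp.287-289] -/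
theorem differentiableAt_chart47W_of_size_le (Y : ι → V) (r : ℝ) (hr : r < ε) (hY : ∀ i, w₀ i * ‖Y i‖ ≤ r) : DifferentiableAt ℂ Dsel Y :=
  (analyticOnNhd_chart47W hw₀ hwB C H hC₂ hB₀ hH hCq hCd hq hR hε Dsel hDball hDfix Y (mem_wBall_of_size_le hr hY)).differentiableAt

/-- `D(·)` is analytic at every sized field. [cite: Balaban1985Variational, Prop. 3 p.289] -/
theorem analyticAt_chart47W_of_size_le (Y : ι → V) (r : ℝ) (hr : r < ε) (hY : ∀ i, w₀ i * ‖Y i‖ ≤ r) : AnalyticAt ℂ Dsel Y :=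
  analyticOnNhd_chart47W hw₀ hwB C H hC₂ hB₀ hH hCq hCd hq hR hε Dsel hDball hDfix Y (mem_wBall_of_size_le hr hY)

/-- The Fréchet derivative at every sized field. [cite: Balaban1985Variational, (63)-(73) pp.287-289] -/
theorem hasFDerivAt_chart47W_of_size_le (Y : ι → V) (r : ℝ) (hr : r < ε) (hY : ∀ i, w₀ i * ‖Y i‖ ≤ r) :
    HasFDerivAt Dsel (fderiv ℂ Dsel Y) Y :=
  (differentiableAt_chart47W_of_size_le hw₀ hwB C H hC₂ hB₀ hH hCq hCd hq hR hε Dsel hDball hDfix Y r hr hY).hasFDerivAt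

omit [Fintype β] [FiniteDimensional ℂ V] hw₀ hwB hC₂ hB₀ hH hCq hCd hq hR hε hDball in
/-- ★ **h49 — THE FIXED-POINT EQUATION HOLDS NEAR EVERY SIZED FIELD**: `size Y ≤ r < ε ⇒ ∀ᶠ X in 𝓝 Y, Dsel X = C (X − H (Dsel X))` (the open ball is a neighbourhood
of `Y` and (49) holds on it). [cite: Balaban1985Variational, (47)-(49) p.285, Prop. 3 p.289] -/
theorem eventually_fix_of_size_le (Y : ι → V) (r : ℝ) (hr : r < ε) (hY : ∀ i, w₀ i * ‖Y i‖ ≤ r) :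
    ∀ᶠ X in 𝓝 Y, Dsel X = C (X - H (Dsel X)) := by
  filter_upwards [(isOpen_wBall w₀ ε).mem_nhds (show Y ∈ {A' : ι → V | ∀ i, w₀ i * ‖A' i‖ < ε} from mem_wBall_of_size_le hr hY)]
    with X hX
  exact (hDfix X hX).symm

omit [Fintype ι] [Fintype β] [FiniteDimensional ℂ V] hwB hB₀ hCq hCd hR hDfix in
/-- **(57): THE SHIFTED FIELD `Y − H·D(Y)` STAYS IN THE `R`-BALL**: `size Y ≤ r < ε ⇒ size (Y − H·Dsel Y) < R` (`≤ r + 4B₀C₂ε² < ε + ε < 3ε ≤ R`).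
[cite: Balaban1985Variational, (54)-(57) p.286] -/
theorem size_shift_lt_of_size_le (hR3 : 3 * ε ≤ R) (Y : ι → V) (r : ℝ) (hr : r < ε) (hY : ∀ i, w₀ i * ‖Y i‖ ≤ r) :
    ∀ i, w₀ i * ‖(Y - H (Dsel Y)) i‖ < R := by
  have hYε := mem_wBall_of_size_le hr hY
  have hHD : ∀ i, w₀ i * ‖H (Dsel Y) i‖ ≤ B₀ * (4 * C₂ * ε ^ 2) := hH _ _ (by positivity) (hDball Y hYε)
  have hx : B₀ * (4 * C₂ * ε ^ 2) < ε := by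
    have h1 : B₀ * (4 * C₂ * ε ^ 2) = 4 * (C₂ * B₀ * ε) * ε := by ring
    have h2 : C₂ * B₀ * ε < 1 / 9 := by nlinarith
    nlinarith
  intro i
  calc w₀ i * ‖(Y - H (Dsel Y)) i‖ ≤ w₀ i * (‖Y i‖ + ‖H (Dsel Y) i‖) :=
        mul_le_mul_of_nonneg_left (norm_sub_le _ _) (hw₀ i).le
    _ = w₀ i * ‖Y i‖ + w₀ i * ‖H (Dsel Y) i‖ := mul_add _ _ _
    _ < ε + ε := add_lt_add ((hY i).trans_lt hr) ((hHD i).trans_lt hx)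
    _ ≤ R := by linarith

omit [Fintype β] [FiniteDimensional ℂ V] hwB hB₀ hCq hDfix in
/-- ★ **hCd — `C` IS ℂ-DIFFERENTIABLE AT THE SHIFTED FIELD**: `size Y ≤ r < ε ⇒ DifferentiableAt ℂ C (Y − H (Dsel Y))` (the `R`-ball is open and contains it).
[cite: Balaban1985Variational, (44)-(48) p.285, Prop. 3 p.289] -/
theorem differentiableAt_shift_of_size_le (Y : ι → V) (r : ℝ) (hr : r < ε) (hY : ∀ i, w₀ i * ‖Y i‖ ≤ r) :
    DifferentiableAt ℂ C (Y - H (Dsel Y)) :=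
  hCd.differentiableAt ((isOpen_wBall w₀ R).mem_nhds
    (show (Y - H (Dsel Y)) ∈ {A' : ι → V | ∀ i, w₀ i * ‖A' i‖ < R} from
      size_shift_lt_of_size_le hw₀ H hC₂ hH hq hε Dsel hDball hR Y r hr hY))

end Main

/-! ## §4 The selector edition of `chart47W`: one analytic map with (49), (50), (55), (48) everywhere on the ball -/

/-- ★★ **[Balaban1985Variational] PROP. 3 IN F4's LETTERS, ANALYTIC SELECTOR EDITION.**  Under the data of `chart47W` there is ONE map `Dsel`, analytic on a
neighbourhood of every point of the `w₀`-ball `< ε` (hence `DifferentiableOn`, `C^ω`, with holomorphic `fderiv`), such that at every `A′` of the ball: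
(49) `C(A′ − H·Dsel A′) = Dsel A′` with size `≤ 4C₂ε²`; (50) uniqueness among `D′` of size `≤ 4C₂ε²`; (55) size `Dsel A′ ≤ 4C₂ρ²` for every size bound `ρ ≥ 0`
of `A′`; (48) `Q_lin(A′ − H·Dsel A′) + C(A′ − H·Dsel A′) = Q_lin A′` for every ℂ-linear left inverse `Q_lin` of `H`.  (`chart47W` pointwise + choice +
`analyticOnNhd_chart47W`.) [cite: Balaban1985Variational, (47)-(55) pp.285-286, Prop. 3 p.289] -/
theorem exists_analytic_chart47W [FiniteDimensional ℂ V] {w₀ : ι → ℝ} {wB : β → ℝ} (hw₀ : ∀ i, 0 < w₀ i) (hwB : ∀ c, 0 < wB c)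
    (C : (ι → V) → (β → V)) (H : (β → V) →ₗ[ℂ] (ι → V)) {C₂ R B₀ ε : ℝ} (hC₂ : 0 ≤ C₂) (hB₀ : 0 ≤ B₀)
    (hH : ∀ (X : β → V) (t : ℝ), 0 ≤ t → (∀ c, wB c * ‖X c‖ ≤ t) → ∀ i, w₀ i * ‖H X i‖ ≤ B₀ * t)
    (hCq : ∀ (Y : ι → V) (r : ℝ), r < R → (∀ i, w₀ i * ‖Y i‖ ≤ r) → ∀ c, wB c * ‖C Y c‖ ≤ C₂ * r ^ 2)
    (hCd : DifferentiableOn ℂ C {Y : ι → V | ∀ i, w₀ i * ‖Y i‖ < R})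
    (hq : 9 * C₂ * B₀ * ε < 1) (hR : 3 * ε ≤ R) (hε : 0 < ε) :
    ∃ Dsel : (ι → V) → (β → V),
      AnalyticOnNhd ℂ Dsel {A' : ι → V | ∀ i, w₀ i * ‖A' i‖ < ε} ∧
      DifferentiableOn ℂ (fderiv ℂ Dsel) {A' : ι → V | ∀ i, w₀ i * ‖A' i‖ < ε} ∧
      ∀ A' : ι → V, (∀ i, w₀ i * ‖A' i‖ < ε) →
        ((∀ c, wB c * ‖Dsel A' c‖ ≤ 4 * C₂ * ε ^ 2) ∧ C (A' - H (Dsel A')) = Dsel A') ∧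
        (∀ D' : β → V, (∀ c, wB c * ‖D' c‖ ≤ 4 * C₂ * ε ^ 2) → C (A' - H D') = D' → D' = Dsel A') ∧
        (∀ ρ : ℝ, 0 ≤ ρ → (∀ i, w₀ i * ‖A' i‖ ≤ ρ) → ∀ c, wB c * ‖Dsel A' c‖ ≤ 4 * C₂ * ρ ^ 2) ∧
        ∀ (Qlin : (ι → V) →ₗ[ℂ] (β → V)), (∀ X, Qlin (H X) = X) → Qlin (A' - H (Dsel A')) + C (A' - H (Dsel A')) = Qlin A' := by
  classical
  -- `chart47W` asks the UNGUARDED (46) letter; with a block bond present a size bound `t` is automatically `≥ 0`, without one everything is vacuous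
  rcases isEmpty_or_nonempty β with hβ | hβ
  · -- no block bonds: `D ≡ 0`; every equation in `β → V` holds vacuously
    let Dsel : (ι → V) → (β → V) := fun _ => 0
    have hDball : ∀ A' : ι → V, (∀ i, w₀ i * ‖A' i‖ < ε) → ∀ c, wB c * ‖Dsel A' c‖ ≤ 4 * C₂ * ε ^ 2 := fun A' _ c => hβ.elim c
    have hDfix : ∀ A' : ι → V, (∀ i, w₀ i * ‖A' i‖ < ε) → C (A' - H (Dsel A')) = Dsel A' := fun A' _ => funext fun c => hβ.elim c
    exact ⟨Dsel, analyticOnNhd_chart47W hw₀ hwB C H hC₂ hB₀ hH hCq hCd hq hR hε Dsel hDball hDfix,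
      differentiableOn_fderiv_chart47W hw₀ hwB C H hC₂ hB₀ hH hCq hCd hq hR hε Dsel hDball hDfix, fun A' hA' =>
        ⟨⟨hDball A' hA', hDfix A' hA'⟩, fun D' _ _ => funext fun c => hβ.elim c, fun ρ _ _ c => hβ.elim c, fun Qlin _ => funext fun c => hβ.elim c⟩⟩
  · have hH' : ∀ (X : β → V) (t : ℝ), (∀ c, wB c * ‖X c‖ ≤ t) → ∀ i, w₀ i * ‖H X i‖ ≤ B₀ * t := by
      intro X t hX
      obtain ⟨c₀⟩ := hβ
      exact hH X t ((mul_nonneg (hwB c₀).le (norm_nonneg _)).trans (hX c₀)) hX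
    have hpt := fun (A' : ι → V) (hA' : ∀ i, w₀ i * ‖A' i‖ < ε) => chart47W hw₀ hwB C H hC₂ hB₀ hH' hCq hCd hq hR hε A' hA'
    let Dsel : (ι → V) → (β → V) := fun A' => if hA' : (∀ i, w₀ i * ‖A' i‖ < ε) then Classical.choose (hpt A' hA') else 0
    have hDsel : ∀ (A' : ι → V) (hA' : ∀ i, w₀ i * ‖A' i‖ < ε), Dsel A' = Classical.choose (hpt A' hA') := fun A' hA' => dif_pos hA'
    have hspec : ∀ (A' : ι → V) (hA' : ∀ i, w₀ i * ‖A' i‖ < ε),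
        ((∀ c, wB c * ‖Dsel A' c‖ ≤ 4 * C₂ * ε ^ 2) ∧ C (A' - H (Dsel A')) = Dsel A') ∧
        (∀ D' : β → V, (∀ c, wB c * ‖D' c‖ ≤ 4 * C₂ * ε ^ 2) → C (A' - H D') = D' → D' = Dsel A') ∧
        (∀ ρ : ℝ, 0 ≤ ρ → (∀ i, w₀ i * ‖A' i‖ ≤ ρ) → ∀ c, wB c * ‖Dsel A' c‖ ≤ 4 * C₂ * ρ ^ 2) ∧
        ∀ (Qlin : (ι → V) →ₗ[ℂ] (β → V)), (∀ X, Qlin (H X) = X) → Qlin (A' - H (Dsel A')) + C (A' - H (Dsel A')) = Qlin A' := by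
      intro A' hA'; rw [hDsel A' hA']; exact Classical.choose_spec (hpt A' hA')
    have hDball : ∀ A' : ι → V, (∀ i, w₀ i * ‖A' i‖ < ε) → ∀ c, wB c * ‖Dsel A' c‖ ≤ 4 * C₂ * ε ^ 2 := fun A' hA' => (hspec A' hA').1.1
    have hDfix : ∀ A' : ι → V, (∀ i, w₀ i * ‖A' i‖ < ε) → C (A' - H (Dsel A')) = Dsel A' := fun A' hA' => (hspec A' hA').1.2
    exact ⟨Dsel, analyticOnNhd_chart47W hw₀ hwB C H hC₂ hB₀ hH hCq hCd hq hR hε Dsel hDball hDfix,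
      differentiableOn_fderiv_chart47W hw₀ hwB C H hC₂ hB₀ hH hCq hCd hq hR hε Dsel hDball hDfix, hspec⟩

/-! ## §5 (73) at norm level in F4's letters: the weighted size of the derivative `δD(A′)∕δA′`, with the sharp `O(size A′)` constant -/

section Deriv

variable [FiniteDimensional ℂ V] {w₀ : ι → ℝ} {wB : β → ℝ} (hw₀ : ∀ i, 0 < w₀ i) (hwB : ∀ c, 0 < wB c)
    (C : (ι → V) → (β → V)) (H : (β → V) →ₗ[ℂ] (ι → V)) {C₂ R B₀ ε : ℝ} (hC₂ : 0 ≤ C₂) (hB₀ : 0 ≤ B₀)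
    (hH : ∀ (X : β → V) (t : ℝ), 0 ≤ t → (∀ c, wB c * ‖X c‖ ≤ t) → ∀ i, w₀ i * ‖H X i‖ ≤ B₀ * t)
    (hCq : ∀ (Y : ι → V) (r : ℝ), r < R → (∀ i, w₀ i * ‖Y i‖ ≤ r) → ∀ c, wB c * ‖C Y c‖ ≤ C₂ * r ^ 2)
    (hCd : DifferentiableOn ℂ C {Y : ι → V | ∀ i, w₀ i * ‖Y i‖ < R})
    (hq : 9 * C₂ * B₀ * ε < 1) (hR : 3 * ε ≤ R) (hε : 0 < ε)
    (Dsel : (ι → V) → (β → V))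
    (hDball : ∀ A' : ι → V, (∀ i, w₀ i * ‖A' i‖ < ε) → ∀ c, wB c * ‖Dsel A' c‖ ≤ 4 * C₂ * ε ^ 2)
    (hDfix : ∀ A' : ι → V, (∀ i, w₀ i * ‖A' i‖ < ε) → C (A' - H (Dsel A')) = Dsel A')

include hw₀ hwB hC₂ hB₀ hH hCq hCd hq hR hε hDball hDfix

/-- ★ **(73) AT NORM LEVEL, WEIGHTED LETTERS, FOR EVERY SOLUTION FAMILY, WITH THE SHARP CONSTANT**: for `A′` in the open `w₀`-ball `< ε` with `w₀`-size `≤ ρ`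
(`0 ≤ ρ`) and a direction `W` of `w₀`-size `≤ t` (`0 ≤ t`): `wB c·‖(δDsel(A′)∕δA′)W (c)‖ ≤ 9C₂ρ(1 − 9C₂B₀ε)⁻¹·t` at every block index — the derivative of the chart is
`O(|A′|)` («D(A′) has an expansion beginning with quadratic terms»), print's (73) `O(1)C₃ε₃` being the case `ρ = ε`.  Transport of lit-balaban's
`B12LinearizAnalytic267.norm_fderiv_Dt_le` (`‖DD̃(B)‖ ≤ 9C₂‖B‖(1 − 9C₂bε)⁻¹`, from `DD̃ = (I + DC̃·h)⁻¹DC̃`, the Cauchy estimate `‖DC̃(Y₀)‖ ≤ 9C₂‖B‖` and Neumann)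
through the `NegSup` identifications and the chain rule for continuous linear equivalences. [cite: Balaban1985Variational, (63)-(73) pp.287-289; Balaban1987RG1, p.267] -/
theorem wsize_fderiv_chart47W_le (A' : ι → V) (hA' : ∀ i, w₀ i * ‖A' i‖ < ε) (ρ : ℝ) (hρ0 : 0 ≤ ρ) (hρ : ∀ i, w₀ i * ‖A' i‖ ≤ ρ)
    (W : ι → V) (t : ℝ) (ht : 0 ≤ t) (hW : ∀ i, w₀ i * ‖W i‖ ≤ t) :
    ∀ c, wB c * ‖fderiv ℂ Dsel A' W c‖ ≤ 9 * C₂ * ρ * (1 - 9 * C₂ * B₀ * ε)⁻¹ * t := by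
  classical
  haveI : CompleteSpace V := FiniteDimensional.complete ℂ V
  haveI : Fact (∀ i, 0 < w₀ i) := ⟨hw₀⟩
  haveI : Fact (∀ c, 0 < wB c) := ⟨hwB⟩
  let eY := NegSup.equiv w₀ V
  let eX := NegSup.equiv wB V
  let eYL := NegSup.continuousLinearEquiv ℂ w₀ (V := V)
  let eXL := NegSup.continuousLinearEquiv ℂ wB (V := V)
  have hρε : 0 ≤ 4 * C₂ * ε ^ 2 := by positivity
  -- the transported data (as in `analyticOnNhd_chart47W`)
  let Hop : NegSup wB V →ₗ[ℂ] NegSup w₀ V :=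
    { toFun := fun X => eY.symm (H (eX X))
      map_add' := fun X X' => by
        apply eY.injective; simp only [Equiv.apply_symm_apply, eY, eX, NegSup.equiv_add, map_add]
      map_smul' := fun z X => by
        apply eY.injective; simp only [Equiv.apply_symm_apply, eY, eX, NegSup.equiv_smul, map_smul, RingHom.id_apply] }
  have hHop : ∀ X, ‖Hop X‖ ≤ B₀ * ‖X‖ := fun X => norm_transport_le H hB₀ hH X
  let Ct : NegSup w₀ V → NegSup wB V := fun Y => eX.symm (C (eY Y))
  have hCt : QuadAnalytic Ct C₂ R := quadAnalytic_transport C hC₂ hCq hCd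
  have hCa : AnalyticOnNhd ℂ Ct {Y : NegSup w₀ V | ‖Y‖ < R} := analyticOnNhd_transport C hCd
  let Dt : NegSup w₀ V → NegSup wB V := fun Y => eX.symm (Dsel (eY Y))
  have hDtball : ∀ B : NegSup w₀ V, ‖B‖ < ε → Dt B ∈ closedBall (0 : NegSup wB V) (4 * C₂ * ε ^ 2) := by
    intro B hB
    rw [mem_closedBall_zero_iff, NegSup.norm_le_iff hρε]
    exact hDball (eY B) ((NegSup.norm_lt_iff hε).1 hB)
  have hDtfix : ∀ B : NegSup w₀ V, ‖B‖ < ε → Ct (B - Hop (Dt B)) = Dt B := by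
    intro B hB
    have h := hDfix (eY B) ((NegSup.norm_lt_iff hε).1 hB)
    exact (congrArg eX.symm h : _)
  -- the base point on the carrier and lit-balaban's derivative bound there
  have hBn : ‖eYL.symm A'‖ < ε := (NegSup.norm_lt_iff hε).2 hA'
  have hBρ : ‖eYL.symm A'‖ ≤ ρ := (NegSup.norm_le_iff hρ0).2 hρ
  have han : AnalyticAt ℂ Dt (eYL.symm A') :=
    B12LinearizAnalytic267.analyticAt_Dt hCt hCa hC₂ hB₀ hHop hq hR hDtball hDtfix hBn
  have hbound : ‖fderiv ℂ Dt (eYL.symm A')‖ ≤ 9 * C₂ * ‖eYL.symm A'‖ * (1 - 9 * C₂ * B₀ * ε)⁻¹ :=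
    B12LinearizAnalytic267.norm_fderiv_Dt_le hCt hCa hC₂ hB₀ hHop hq hR hDtball hDtfix hBn
  -- chain rule: `Dsel = eXL ∘ Dt ∘ eYL⁻¹`
  have hcomp : HasFDerivAt (⇑eXL ∘ (Dt ∘ ⇑eYL.symm))
      ((eXL : NegSup wB V →L[ℂ] (β → V)) ∘L (fderiv ℂ Dt (eYL.symm A') ∘L (eYL.symm : (ι → V) →L[ℂ] NegSup w₀ V))) A' :=
    eXL.hasFDerivAt.comp A' (han.differentiableAt.hasFDerivAt.comp A' eYL.symm.hasFDerivAt)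
  have hD : Dsel = ⇑eXL ∘ (Dt ∘ ⇑eYL.symm) := rfl
  have hfd : fderiv ℂ Dsel A' W = eXL (fderiv ℂ Dt (eYL.symm A') (eYL.symm W)) := by
    rw [hD, hcomp.fderiv]; rfl
  -- the weighted size of the image
  have hq1 : 0 < 1 - 9 * C₂ * B₀ * ε := sub_pos.2 hq
  have hK : 0 ≤ 9 * C₂ * ρ * (1 - 9 * C₂ * B₀ * ε)⁻¹ := by positivity
  have hWn : ‖eYL.symm W‖ ≤ t := (NegSup.norm_le_iff ht).2 hW
  intro c
  calc wB c * ‖fderiv ℂ Dsel A' W c‖ = wB c * ‖NegSup.equiv wB V (fderiv ℂ Dt (eYL.symm A') (eYL.symm W)) c‖ := by rw [hfd]; rfl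
    _ ≤ ‖fderiv ℂ Dt (eYL.symm A') (eYL.symm W)‖ := NegSup.weight_mul_norm_apply_le _ c
    _ ≤ ‖fderiv ℂ Dt (eYL.symm A')‖ * ‖eYL.symm W‖ := ContinuousLinearMap.le_opNorm _ _
    _ ≤ (9 * C₂ * ‖eYL.symm A'‖ * (1 - 9 * C₂ * B₀ * ε)⁻¹) * t := mul_le_mul hbound hWn (norm_nonneg _) (by positivity)
    _ ≤ (9 * C₂ * ρ * (1 - 9 * C₂ * B₀ * ε)⁻¹) * t := by
        apply mul_le_mul_of_nonneg_right _ ht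
        have h9 : 0 ≤ 9 * C₂ := by positivity
        have := mul_le_mul_of_nonneg_left hBρ h9
        exact mul_le_mul_of_nonneg_right this (inv_nonneg.2 hq1.le)

end Deriv

end Summit.QuantumFields.YangMills.Theorems.Chart47Analytic

end
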